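import Summits.CriticalPhenomena.CardyFormulaZ2.Theorems.CardyBoundaryCoulombGasHalfPlaneMarkDensityLawPosNearestLeftWindow
import Summits.CriticalPhenomena.CardyFormulaZ2.Theorems.CardyBoundaryCoulombGasHalfPlaneMarkDensityLawPosNearestLeftShift
import Summits.CriticalPhenomena.CardyFormulaZ2.Theorems.CardyBoundaryCoulombGasHalfPlaneMarkDensityLawPosNearestLeftLower
import Summits.CriticalPhenomena.CardyFormulaZ2.Theorems.CardyBoundaryCoulombGasHalfPlaneMarkDensityLawPosFirstHitOfCluster
import Summits.CriticalPhenomena.CardyFormulaZ2.Theorems.CardyBoundaryCoulombGasHalfPlaneMarkDensityLawPosHClusterToolkit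
import Summits.CriticalPhenomena.CardyFormulaZ2.Theorems.CardyBoundaryCoulombGasHalfPlaneMarkDensityLawPosDecoupling
import Summits.CriticalPhenomena.CardyFormulaZ2.Theorems.CardyBoundaryCoulombGasHalfPlaneMarkDensityLawPosDensityPositivityOf
import Summits.CriticalPhenomena.CardyFormulaZ2.Theorems.CardyBoundaryCoulombGasHalfPlaneMarkDensityLawDensityIdentification

/-!
# `HalfPlaneMarkDensityLaw` (crux stmt-CriticalPhenomena-5661), line `Sketch`, cycle 4 (`Positivity`), lead c12-0:
# assembly — **THE LATTICE MARK DENSITY IS BOUNDED BELOW: `liminf_n n·P[E_n(a,b,c,x)] > 0`**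
# (registered stub `stub_densityPositivity`, separation-free)

`lawSeq a b c x n = n · P_{1/2}[E_n]`, `E_n` = "`(⌊xn⌋,0)` is the `c`-most point of `[⌊cn⌋,∞)×{0}` joined
inside `ℤ×ℕ` to `[⌊an⌋,⌊bn⌋]×{0}`" — the crux asserts `lawSeq → Cardy's density`; here: it is eventually
bounded below by a positive constant, for every chamber point, along the FULL sequence.  Composition of the
landed stubs of `Lines/Sketch_Positivity2.lean`:

* counting for the nearest-left-neighbour statistic (`stub_nearestLeft_of_window` p132769,
  `stub_nearestLeft_shift` p132774, glue `stub_nearestLeft_lowerBound_of`): on this seat's window event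
  (`Window.stub_windowLowerBound`) the leftmost joined point has its nearest-left `H`-cluster neighbour in a
  prescribed macroscopic range; the translates of that event cover the window event, so
  `n · P[NL(⌊xn⌋; ⌊an⌋, ⌊bn⌋)] ≥ c₀` (`stub_nearestLeft_lowerBound`);
* decoupling by the law of the `H`-cluster (`stub_firstHit_of_hCluster`, `stub_mem_hCluster_iff`,
  `stub_hCluster_indep`, `stub_hCluster_measurable`, glue `stub_firstHit_decoupling_of`): given the `H`-cluster
  `S` of `(k,0)` with nearest-left neighbour in `A_n`, `E_n` fails only through an open path of `H` OFF `S`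
  from `A_n` right of `t` to `[⌊cn⌋,k)` (planarity, `TwoArmLower.stub_interleave`), independent of `S` and of
  probability `≤ P_n(a,b,c,x) ≤ 1 − c₁` (`Window.stub_eventually_le_one_sub`): `P[E_n] ≥ c₁ · P[NL]`
  (`stub_firstHit_decoupling`);
* hence `lawSeq a b c x n ≥ c₁ c₀ > 0` eventually (`stub_densityPositivity`), and for every joint
  subsequential limit `G` along `θ`: **`∂₄G(a,b,c,x) > 0` at EVERY chamber point** (`deriv_jointLimit_pos`;
  c4-0: `lawSeq ∘ θ → ∂₄G`), sharpening the open-dense-set statement of cycle 3.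

No arm separation / extendability is used: the sharp exponent enters only through the exact window identity
(Russo in the fourth mark) and the translation invariance of the nearest-neighbour statistic.
-/

noncomputable section

namespace Summit.CriticalPhenomena.CardyFormulaZ2.Cruxes.HalfPlaneMarkDensityLaw.SketchLine

open Literature.Probability.Percolation Literature.Probability.LatticeModels
open MeasureTheory Filter Set SimpleGraph
open scoped Topology
open Summit.CriticalPhenomena.CardyFormulaZ2.Theorems.HalfPlaneMarkDensityLaw.Negative

namespace Positivity

/-- **Q3. `n · P[NL(⌊xn⌋; ⌊an⌋, ⌊bn⌋)] ≥ c₀ > 0` eventually** (`a < b < x`): the nearest bottom point left of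
`(⌊xn⌋,0)` in its `H`-cluster lies in `A_n` with probability `≍ 1/n` at least. [folklore] -/
theorem stub_nearestLeft_lowerBound :
    ∀ (a b x : ℝ), a < b → b < x → ∃ c₀ : ℝ, 0 < c₀ ∧ ∀ᶠ n : ℕ in atTop, c₀ ≤ (n : ℝ) * μ.real {ω : BondConfig (Site 2) | ∃ t : ℤ, ⌊a * n⌋ ≤ t ∧ t ≤ ⌊b * n⌋ ∧ ω ∈ openConnIn halfPlane (bpt (⌊x * n⌋)) (bpt t) ∧ ∀ s : ℤ, t < s → s < ⌊x * n⌋ → ω ∉ openConnIn halfPlane (bpt (⌊x * n⌋)) (bpt s)} :=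
  stub_nearestLeft_lowerBound_of stub_nearestLeft_of_window stub_nearestLeft_shift

/-- **Q8. Decoupling: `(1 − q)·P[NL(k; lo, hi)] ≤ P[firstHit halfPlane ([lo,hi]×{0}) cl k]`** whenever every
escape crossing `[t+1,hi]×{0} ↔ [cl,k−1]×{0}` of `H`, `t ∈ [lo,hi]`, has probability `≤ q`. [folklore] -/
theorem stub_firstHit_decoupling :
    ∀ (k lo hi cl : ℤ) (q : ℝ), lo ≤ hi → hi < cl → cl ≤ k → (∀ t : ℤ, lo ≤ t → t ≤ hi → μ.real (openCrossing halfPlane (rowIcc (t + 1) hi) (rowIcc cl (k - 1))) ≤ q) → (1 - q) * μ.real {ω : BondConfig (Site 2) | ∃ t : ℤ, lo ≤ t ∧ t ≤ hi ∧ ω ∈ openConnIn halfPlane (bpt (k)) (bpt t) ∧ ∀ s : ℤ, t < s → s < k → ω ∉ openConnIn halfPlane (bpt (k)) (bpt s)} ≤ μ.real (firstHit halfPlane (rowIcc lo hi) cl k) :=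
  stub_firstHit_decoupling_of stub_firstHit_of_hCluster stub_mem_hCluster_iff stub_hCluster_indep
    stub_hCluster_measurable

end Positivity

namespace TwoArmLower

/-- **POSITIVITY OF THE LATTICE MARK DENSITY** (registered stub `stub_densityPositivity` of line `Sketch`):
for all `a < b < c < x` there is `c₁ > 0` with `c₁ ≤ n · P_{1/2}[E_n(a,b,c,x)]` for all large `n` — the
crux's sequence is bounded away from `0` along the full sequence (the crux asserts its convergence to
Cardy's density).  Separation-free: nearest-left counting + `H`-cluster decoupling. [folklore] -/
theorem stub_densityPositivity :
    ∀ (a b c x : ℝ), a < b → b < c → c < x → ∃ c₁ : ℝ, 0 < c₁ ∧ ∀ᶠ n : ℕ in atTop, c₁ ≤ lawSeq a b c x n :=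
  Positivity.stub_densityPositivity_of Positivity.stub_nearestLeft_lowerBound Positivity.stub_firstHit_decoupling

end TwoArmLower

namespace Positivity

/-- **Every joint subsequential scaling limit has a STRICTLY POSITIVE fourth-mark derivative at every
chamber point**: `∂₄G(a,b,c,x) > 0` — the subsequential density limits of the crux never vanish. [folklore] -/
theorem deriv_jointLimit_pos {θ : ℕ → ℕ} {G : ℝ → ℝ → ℝ → ℝ → ℝ}
    (hG : ∀ a b c y : ℝ, a < b → b < c → c < y →
      Tendsto (fun n ↦ μ.real (openCrossing halfPlane (arcA a b (θ n))
        (rowIcc ⌊c * (θ n : ℕ)⌋ ⌊y * (θ n : ℕ)⌋))) atTop (𝓝 (G a b c y)))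
    (hθ : StrictMono θ) {a b c x : ℝ} (hab : a < b) (hbc : b < c) (hcx : c < x) :
    0 < deriv (G a b c) x := by
  obtain ⟨c₁, hc₁, hev⟩ := TwoArmLower.stub_densityPositivity a b c x hab hbc hcx
  have hlim := (Density.hasDerivAt_jointLimit hG hθ.tendsto_atTop hab hbc hcx).2
  exact lt_of_lt_of_le hc₁ (ge_of_tendsto hlim (hθ.tendsto_atTop.eventually hev))


/-- **… and a strictly NEGATIVE first-mark derivative at every chamber point**: `∂₁G(a,b,c,y) < 0`
(`∂₁G(a,b,c,y) = −∂₄G(−y,−c,−b,−a)` by the lattice reflection, c4-0). [folklore] -/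
theorem deriv_jointLimit_first_neg {θ : ℕ → ℕ} {G : ℝ → ℝ → ℝ → ℝ → ℝ}
    (hG : ∀ a b c y : ℝ, a < b → b < c → c < y →
      Tendsto (fun n ↦ μ.real (openCrossing halfPlane (arcA a b (θ n))
        (rowIcc ⌊c * (θ n : ℕ)⌋ ⌊y * (θ n : ℕ)⌋))) atTop (𝓝 (G a b c y)))
    (hθ : StrictMono θ) {a b c y : ℝ} (hab : a < b) (hbc : b < c) (hcy : c < y) :
    deriv (fun s ↦ G s b c y) a < 0 := by
  rw [(Density.hasDerivAt_jointLimit_first hG hθ hab hbc hcy).1.deriv]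
  have h := deriv_jointLimit_pos hG hθ (a := -y) (b := -c) (c := -b) (x := -a)
    (by linarith) (by linarith) (by linarith)
  linarith

/-- **`liminf` form**: every subsequential limit `L` of the crux's sequence `n · P[E_n(a,b,c,x)]` is positive.
[folklore] -/
theorem pos_of_tendsto_lawSeq {θ : ℕ → ℕ} (hθ : StrictMono θ) {a b c x L : ℝ} (hab : a < b) (hbc : b < c)
    (hcx : c < x) (hL : Tendsto (fun j ↦ lawSeq a b c x (θ j)) atTop (𝓝 L)) : 0 < L := by
  obtain ⟨c₁, hc₁, hev⟩ := TwoArmLower.stub_densityPositivity a b c x hab hbc hcx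
  exact lt_of_lt_of_le hc₁ (ge_of_tendsto hL (hθ.tendsto_atTop.eventually hev))

end Positivity

end Summit.CriticalPhenomena.CardyFormulaZ2.Cruxes.HalfPlaneMarkDensityLaw.SketchLine
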